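import Mathlib
import HarnessLib
import Literature.MathematicalPhysics.QuantumLattice.HubbardEffectiveActionCTSymmetry
import Summits.HubbardSuperconductivity.HubbardSuperconductivity.Theorems.KLProgrammeLocalisedCooperD4
import Summits.HubbardSuperconductivity.HubbardSuperconductivity.Theorems.KLProgrammeKLRegimeCountertermFlatCutoffGrid

/-!
# Route `KLProgramme`, crux K3 (stmt-HubbardSuperconductivity-19937) — `D₄`-SYMMETRY OF THE LATTICE DATA OF A G-EXTENSION from the angular
# symmetries of `f`, and the grid reading `(klFrameExtG L μ f)(p_k) = f(θ(k))` on flat-tube sites WITHOUT symmetry hypotheses on the data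

Cell gate-hubbard-kl, seat p1b (g4).  Discharges the three data-symmetry hypotheses of `eval_klFrameExtG_latticeMomentum_of_flat`
(`…CountertermFlatCutoffGrid`, p1b) — evenness, axis reflection, diagonal swap of `g(k) = mean f + χ_flat(k)(f(θ(k)) − mean f)` on the
torus sites — from: `f` `2π`-periodic, `f(−θ) = f(θ)` and `f(θ + π/2) = f(θ)` (the `D₄` symmetry of an angular profile), and `μ ≤ −1/10`
(so that zone-boundary sites, where the centred representative's polar angle is NOT covariant, lie off the doubled flat tube: there
`ε_L ≥ 0 ≥ μ + 2·klFlatR` and `χ_flat = 0`).  Tools: `rotSite`/`reflSite` (`PairCorrelations`), `torusBand_rotSite/_reflSite`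
(`HubbardEffectiveActionCTSymmetry`), `momentumAngle_rotSite/_reflSite` (`…LocalisedCooperD4`, as `Real.Angle` identities off the boundary).
Main results: `klFrameExtG_datum_rotSite`, `klFrameExtG_datum_reflSite`, `klFrameExtG_datum_neg/_refl/_swap`, and
**`eval_klFrameExtG_latticeMomentum_of_flat_of_symm`**: `(klFrameExtG L μ f).eval (latticeMomentum L k) = f (momentumAngle L k)` for every
flat-tube site `k` (`|ξ_μ(k)| ≤ klFlatR`).  Proofs only; nothing is asserted about the model.
-/

noncomputable section

namespace Summit.HubbardSuperconductivity.HubbardSuperconductivity.Theorems.KLRegimeSplit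

set_option linter.dupNamespace false -- summit = problem name (single-conjunct summit), D-0017

open Real Literature.MathematicalPhysics.QuantumLattice Literature.Probability.LatticeModels
open Summit.HubbardSuperconductivity.HubbardSuperconductivity.Theorems.KLProgrammeLegKernels

variable (L : ℕ) [NeZero L]

/-! ## §1 The flat cutoff under the lattice symmetries; zone-boundary sites are far sites -/

/-- `χ_flat(rot k) = χ_flat(k)`. -/
theorem klFlatCutoff_rotSite (μ : ℝ) (k : TorusSite 2 L) : klFlatCutoff L μ (rotSite k) = klFlatCutoff L μ k := by
  unfold klFlatCutoff nambuXi; rw [torusBand_rotSite]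

/-- `χ_flat(refl k) = χ_flat(k)`. -/
theorem klFlatCutoff_reflSite (μ : ℝ) (k : TorusSite 2 L) : klFlatCutoff L μ (reflSite k) = klFlatCutoff L μ k := by
  unfold klFlatCutoff nambuXi; rw [torusBand_reflSite]

/-- A zone-boundary site in the second coordinate (`2·k₁.val = L`, centred momentum `p₁ = π`) has `ε_L(k) ≥ 0`. -/
theorem torusBand_nonneg_of_boundary_one {k : TorusSite 2 L} (hk : 2 * (k 1).val = L) : 0 ≤ torusBand L k := by
  have hL : (0 : ℝ) < L := Nat.cast_pos.2 (Nat.pos_of_ne_zero (NeZero.ne L))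
  have hπ : latticeMomentum L k 1 = π := by
    simp only [latticeMomentum]
    have : (((k 1).val : ℕ) : ℝ) = L / 2 := by
      have h := congrArg (fun n : ℕ => (n : ℝ)) hk
      push_cast at h
      linarith
    rw [this]; field_simp
  simp only [torusBand, Fin.sum_univ_two, hπ, Real.cos_pi]
  linarith [Real.cos_le_one (latticeMomentum L k 0)]

/-- A zone-boundary site in the first coordinate (`2·k₀.val = L`) has `ε_L(k) ≥ 0`. -/
theorem torusBand_nonneg_of_boundary_zero {k : TorusSite 2 L} (hk : 2 * (k 0).val = L) : 0 ≤ torusBand L k := by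
  have hL : (0 : ℝ) < L := Nat.cast_pos.2 (Nat.pos_of_ne_zero (NeZero.ne L))
  have hπ : latticeMomentum L k 0 = π := by
    simp only [latticeMomentum]
    have : (((k 0).val : ℕ) : ℝ) = L / 2 := by
      have h := congrArg (fun n : ℕ => (n : ℝ)) hk
      push_cast at h
      linarith
    rw [this]; field_simp
  simp only [torusBand, Fin.sum_univ_two, hπ, Real.cos_pi]
  linarith [Real.cos_le_one (latticeMomentum L k 1)]

/-- For `μ ≤ −1/10`, a site with `ε_L(k) ≥ 0` is off the doubled flat tube: `χ_flat(k) = 0`. -/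
theorem klFlatCutoff_eq_zero_of_torusBand_nonneg {μ : ℝ} (hμ : μ ≤ -(1 / 10)) {k : TorusSite 2 L} (hk : 0 ≤ torusBand L k) :
    klFlatCutoff L μ k = 0 := by
  refine klFlatCutoff_eq_zero_of_le_abs L ?_
  unfold nambuXi klFlatR
  rw [abs_of_nonneg (by linarith)]
  linarith

/-! ## §2 The lattice data of `klFrameExtG` under the generators `rot`, `refl` -/

/-- Shorthand-free statement: the datum `g(k) = mean f + χ_flat(k)·(f(θ(k)) − mean f)`. -/
theorem klFrameExtG_datum_eq_mean_of_cutoff_zero {μ : ℝ} (f : ℝ → ℝ) {k : TorusSite 2 L} (h : klFlatCutoff L μ k = 0) :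
    klAngularMean f + klFlatCutoff L μ k * (f (momentumAngle L k) - klAngularMean f) = klAngularMean f := by
  rw [h]; ring

/-- In `ZMod L`, `2·x.val = L` forces `−x = x`. -/
theorem neg_eq_self_of_two_mul_val {x : ZMod L} (hx : 2 * x.val = L) : -x = x := by
  have h : x + x = 0 := by
    have h1 : ((x.val + x.val : ℕ) : ZMod L) = ((L : ℕ) : ZMod L) := by rw [← two_mul, hx]
    rw [ZMod.natCast_self, Nat.cast_add, ZMod.natCast_zmod_val] at h1
    exact h1
  exact neg_eq_of_add_eq_zero_right h

/-- **Datum at the reflected site**: for `f` `2π`-periodic and even, `g(refl k) = g(k)`. -/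
theorem klFrameExtG_datum_reflSite {μ : ℝ} {f : ℝ → ℝ} (hper : Function.Periodic f (2 * π)) (heven : ∀ θ, f (-θ) = f θ)
    (k : TorusSite 2 L) :
    klAngularMean f + klFlatCutoff L μ (reflSite k) * (f (momentumAngle L (reflSite k)) - klAngularMean f) =
      klAngularMean f + klFlatCutoff L μ k * (f (momentumAngle L k) - klAngularMean f) := by
  by_cases hk : 2 * (k 1).val = L
  · -- the site is fixed by the reflection
    have hfix : reflSite k = k := by
      ext i; fin_cases i
      · simp [reflSite]
      · simp [reflSite, neg_eq_self_of_two_mul_val L hk]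
    rw [hfix]
  · rw [klFlatCutoff_reflSite]
    have h := momentumAngle_reflSite L hk
    rw [← Real.Angle.coe_neg, Real.Angle.angle_eq_iff_two_pi_dvd_sub] at h
    obtain ⟨z, hz⟩ := h
    rw [show momentumAngle L (reflSite k) = -momentumAngle L k + z * (2 * π) by linarith, hper.int_mul z, heven]

/-- **Datum at the rotated site**: for `f` `2π`-periodic with `f(θ + π/2) = f(θ)` and `μ ≤ −1/10`, `g(rot k) = g(k)`. -/
theorem klFrameExtG_datum_rotSite {μ : ℝ} (hμ : μ ≤ -(1 / 10)) {f : ℝ → ℝ} (hper : Function.Periodic f (2 * π))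
    (hquart : ∀ θ, f (θ + π / 2) = f θ) (k : TorusSite 2 L) :
    klAngularMean f + klFlatCutoff L μ (rotSite k) * (f (momentumAngle L (rotSite k)) - klAngularMean f) =
      klAngularMean f + klFlatCutoff L μ k * (f (momentumAngle L k) - klAngularMean f) := by
  by_cases hk0 : k = 0
  · subst hk0
    have : rotSite (0 : TorusSite 2 L) = 0 := by ext i; fin_cases i <;> simp [rotSite]
    rw [this]
  by_cases hk : 2 * (k 1).val = L
  · -- zone boundary: both sites are far sites
    have h1 : klFlatCutoff L μ k = 0 :=
      klFlatCutoff_eq_zero_of_torusBand_nonneg L hμ (torusBand_nonneg_of_boundary_one L hk)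
    have h2 : klFlatCutoff L μ (rotSite k) = 0 := by
      rw [klFlatCutoff_rotSite]; exact h1
    rw [klFrameExtG_datum_eq_mean_of_cutoff_zero L f h1, klFrameExtG_datum_eq_mean_of_cutoff_zero L f h2]
  · rw [klFlatCutoff_rotSite]
    have h := momentumAngle_rotSite L hk0 hk
    rw [← Real.Angle.coe_add, Real.Angle.angle_eq_iff_two_pi_dvd_sub] at h
    obtain ⟨z, hz⟩ := h
    rw [show momentumAngle L (rotSite k) = momentumAngle L k + π / 2 + z * (2 * π) by linarith, hper.int_mul z, hquart]

/-! ## §3 The three symmetries consumed by the interpolation theorem -/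

section Symm

variable {μ : ℝ} (hμ : μ ≤ -(1 / 10)) {f : ℝ → ℝ} (hper : Function.Periodic f (2 * π)) (heven : ∀ θ, f (-θ) = f θ)
  (hquart : ∀ θ, f (θ + π / 2) = f θ)
include hμ hper hquart

/-- **Evenness of the data**: `g(−k) = g(k)` (`−k = rot (rot k)`). -/
theorem klFrameExtG_datum_neg (k : TorusSite 2 L) :
    klAngularMean f + klFlatCutoff L μ (-k) * (f (momentumAngle L (-k)) - klAngularMean f) =
      klAngularMean f + klFlatCutoff L μ k * (f (momentumAngle L k) - klAngularMean f) := by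
  have h : -k = rotSite (rotSite k) := by ext i; fin_cases i <;> simp [rotSite]
  rw [h, klFrameExtG_datum_rotSite L hμ hper hquart, klFrameExtG_datum_rotSite L hμ hper hquart]

include heven in
/-- **Diagonal swap of the data**: `g(k₁, k₀) = g(k₀, k₁)` (`swap = rot ∘ refl`). -/
theorem klFrameExtG_datum_swap (k : TorusSite 2 L) :
    klAngularMean f + klFlatCutoff L μ ![k 1, k 0] * (f (momentumAngle L ![k 1, k 0]) - klAngularMean f) =
      klAngularMean f + klFlatCutoff L μ k * (f (momentumAngle L k) - klAngularMean f) := by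
  have h : (![k 1, k 0] : TorusSite 2 L) = rotSite (reflSite k) := by ext i; fin_cases i <;> simp [rotSite, reflSite]
  rw [h, klFrameExtG_datum_rotSite L hμ hper hquart, klFrameExtG_datum_reflSite L hper heven]

omit hμ hquart in
include heven in
/-- **Axis reflection of the data**: `g(k₀, −k₁) = g(k)` (`= refl k`). -/
theorem klFrameExtG_datum_refl (k : TorusSite 2 L) :
    klAngularMean f + klFlatCutoff L μ ![k 0, -k 1] * (f (momentumAngle L ![k 0, -k 1]) - klAngularMean f) =
      klAngularMean f + klFlatCutoff L μ k * (f (momentumAngle L k) - klAngularMean f) :=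
  klFrameExtG_datum_reflSite L hper heven k

include heven in
/-- **GRID READING FROM THE ANGULAR SYMMETRIES ALONE.**  For `μ ≤ −1/10` and a `2π`-periodic angular profile `f` with `f(−θ) = f(θ)`,
`f(θ + π/2) = f(θ)`: at every flat-tube site (`|ξ_μ(k)| ≤ klFlatR`) the G-extension reads `f` —
`(klFrameExtG L μ f).eval (latticeMomentum L k) = f (momentumAngle L k)`. -/
theorem eval_klFrameExtG_latticeMomentum_of_flat_of_symm {k : TorusSite 2 L} (hk : |nambuXi L μ k| ≤ klFlatR) :
    (klFrameExtG L μ f).eval (latticeMomentum L k) = f (momentumAngle L k) :=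
  eval_klFrameExtG_latticeMomentum_of_flat L f (klFrameExtG_datum_neg L hμ hper hquart)
    (klFrameExtG_datum_refl L hper heven) (klFrameExtG_datum_swap L hμ hper heven hquart) hk

include heven in
/-- **Every lattice momentum**: the G-extension reads its own datum (the mean off the doubled tube, `f` on the flat tube). -/
theorem eval_klFrameExtG_latticeMomentum_of_symm (k : TorusSite 2 L) :
    (klFrameExtG L μ f).eval (latticeMomentum L k) =
      klAngularMean f + klFlatCutoff L μ k * (f (momentumAngle L k) - klAngularMean f) :=
  eval_klFrameExtG_latticeMomentum L f (klFrameExtG_datum_neg L hμ hper hquart)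
    (klFrameExtG_datum_refl L hper heven) (klFrameExtG_datum_swap L hμ hper heven hquart) k

end Symm

end Summit.HubbardSuperconductivity.HubbardSuperconductivity.Theorems.KLRegimeSplit

end
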